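/-
Copyright: b2b-lace packet (enumeration shard B, gen 10).  The END-POINT regrouping of sums over self-avoiding
walk words by lattice point classes: `Σ_{u ∈ SAW_n} F(u(n)) = Σ_x c_n(x) F(x) = Σ_N #class(N) · c_n(x_N) F(x_N)`
for `W_d`-invariant `F`, with the `W_d`-invariance of the SAW counts `c_n(x) = #SAW_n(0 → x)` PROVED (the
hyperoctahedral group acts on step words).  Pure combinatorics over the tree's own definitions; no numerals;
no cell is changed; nothing of the record is touched.
-/
import Literature.Probability.FitznerVanDerHofstad2017.LatticePointClassesRegroup
import Literature.Probability.Percolation.SusceptibilityPathCounting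
import Literature.Barriers.CriticalPhenomena.LaceExpansionXSpaceAsymptotics
import HarnessLib

/-!
# Sums over self-avoiding words regrouped by end-point classes (`c_n(x)` is `W_d`-invariant)

CITATION HEADER (PLACEMENT v2). This module is part of a certified REPRODUCTION of:
R. Fitzner, R. van der Hofstad, *Mean-field behavior for nearest-neighbor percolation in d > 10*,
Electron. J. Probab. 22 (2017), no. 43, 1–65 [FvdH17], and *Generalized approach to the non-backtracking
lace expansion*, Probab. Theory Related Fields 169 (2017), 1041–1119 [NoBLE17-I] (arXiv:1506.07977, 1506.07969).
Reproduces: the elementary regrouping behind the explicit terms of [NoBLE17-I] §5.3.1 (5.38) / §5.3.3 —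
"`μ̄^i (a_i ⊗ X)(x)`, the sum over all `x ∈ ℤ^d`" is evaluated in the accompanying notebooks as a sum over
END-POINT CLASSES of `|class| · c_i(class) · X(class representative)`, where `c_i(x)` is the number of `i`-step
self-avoiding walks `0 → x`.  Here, for the tree's step words (`Percolation.sawWords d n`, `sawWordsTo d n x`,
`wordPos`): (1) the signed coordinate permutations `W_d` (`LatticeModels.Site.signedPerm π ε`) act on step words
through an explicit permutation `stepPerm π ε` of the `2d` directions (`φ e_κ = e_{σκ}`; the existential form is
the tree's `NobleSymmetry.exists_stepVec_perm`), transporting `wordPos` and self-avoidance, whence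
**`c_n(φx) = c_n(x)`** (`card_sawWordsTo_signedPerm`, `signedPermInvariant_card_sawWordsTo`); (2) end points of
`n`-step words lie in the box `{‖x‖_∞ ≤ n}` (`wordPos_mem_absBox`); (3) **`Σ_{u ∈ SAW_n} F(u(n)) =
Σ_{x ∈ box} c_n(x) • F x`** (`sum_sawWords_eq_sum_absBox`) and, with `LatticePointClassesRegroup`, **`= Σ_N Σ_{x ∈
class N} c_n(x) • F x`** (`sum_sawWords_eq_sum_pointClass`) and for `W_d`-invariant `F` **`= Σ_N #class(N) • (c_n(x_N) •
F x_N)`** at any class representatives (`SignedPermInvariant.sum_sawWords_eq`).  Origin: build `lace`, node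
N67-W⁺/W2 (b′) of `LEMMAS.md` §24: the (E1) regrouping N67-S3 applies to the finite sums
`Σ_{u ∈ sawWords d i} ‖u(i)‖₂² τ̄(u(i))` of `WeightedBubbleSkeletonF3` (with `signedPermInvariant_euclidNorm_sq` and
the `W_d`-invariance of the two-point majorant, which is the consumer's input).

## What is here

* `stepPerm π ε : Equiv.Perm (Fin d × Bool)` with `signedPerm_stepVec : φ (e_κ) = e_{stepPerm π ε κ}`;
  `wordPos_stepPerm_comp : wordPos (σ ∘ u) k = φ (wordPos u k)`, `isSAW_stepPerm_comp_iff`,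
  `stepPerm_comp_mem_sawWordsTo_iff`, **`card_sawWordsTo_signedPerm`**, `signedPermInvariant_card_sawWordsTo`;
* `wordPos_succ'`, `natAbs_wordPos_apply_le` (`|u(k)_μ| ≤ k`), `wordPos_mem_absBox`;
* `mem_sawWordsTo`, **`sum_sawWords_eq_sum_absBox`**, `sum_sawWords_eq_sum_pointClass`, `SignedPermInvariant.smul`,
  **`SignedPermInvariant.sum_sawWords_eq`**, `card_sawWords_eq_sum_pointClass`;
* the bridge `isZdSymmetric_iff_signedPermInvariant` (the tree's real-valued `IsZdSymmetric` of
  `LaceExpansionXSpaceAsymptotics` IS `SignedPermInvariant` at `β = ℝ`, so e.g. `SimpleDiagramFourierBound.isZdSymmetric_tau`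
  feeds these lemmas) and the consumer-shaped **`sum_sawWords_sqNorm_mul_eq_sum_pointClass`**:
  `Σ_{u ∈ SAW_n} ofReal ‖u(n)‖₂² · ofReal G(u(n)) = Σ_N #class • (c_n(x_N) • (ofReal ‖x_N‖₂² · ofReal G(x_N)))` for
  `IsZdSymmetric G` — literally the inner sums of `WeightedBubbleSkeletonF3` with `G = τ_p(0,·)`.

## What is NOT here

No value of any `c_n(x)` (the exact counts are the enumeration shard's certified tables, elsewhere), no two-point
function, no cell; nothing numerical.  No cited fact, no named hypothesis, no `sorry`.

## References
* [NoBLE17-I] R. Fitzner, R. van der Hofstad, Generalized approach to the non-backtracking lace expansion,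
  Probab. Theory Relat. Fields 169 (2017) 1041–1119; arXiv:1506.07969 — §5.3.1 (5.38), §5.3.3; Def. 2.5 (the
  lattice symmetries `p(x; ν, δ)` are signed permutations).
* G. Grimmett, Percolation, 2nd ed. (1999), §1.4 p. 15 (step words code the walks of `𝕃^d`).
-/

namespace Literature.Probability.FitznerVanDerHofstad2017

open Finset Literature.Probability.LatticeModels Literature.Probability.Percolation
open Literature.Barriers.CriticalPhenomena

variable {d n : ℕ}

/-! ### `W_d` acts on step words -/

/-- The permutation of the `2d` directions `{±e_1, …, ±e_d}` induced by the signed coordinate permutation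
`(π, ε)`: `(i, ±) ↦ (π i, ±')` with the sign flipped iff `ε_{π i} = −1` (so that `φ e_κ = e_{σ κ}`,
`signedPerm_stepVec`).  Explicit form of the tree's `NobleSymmetry.exists_stepVec_perm`.
[cite: FitznerVanDerHofstad2016NoBLE, Def. 2.5 p. 1058 (p(x;ν,δ) permutes the unit vectors)] -/
def stepPerm (π : Equiv.Perm (Fin d)) (ε : Fin d → ℤˣ) : Equiv.Perm (Fin d × Bool) where
  toFun κ := (π κ.1, if (ε (π κ.1) : ℤ) = 1 then κ.2 else !κ.2)
  invFun κ := (π.symm κ.1, if (ε κ.1 : ℤ) = 1 then κ.2 else !κ.2)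
  left_inv κ := by
    obtain ⟨i, b⟩ := κ
    by_cases h : (ε (π i) : ℤ) = 1 <;> simp [h]
  right_inv κ := by
    obtain ⟨i, b⟩ := κ
    by_cases h : (ε i : ℤ) = 1 <;> simp [h]

/-- `stepPerm` on a direction, unfolded. [folklore] -/
theorem stepPerm_apply (π : Equiv.Perm (Fin d)) (ε : Fin d → ℤˣ) (κ : Fin d × Bool) :
    stepPerm π ε κ = (π κ.1, if (ε (π κ.1) : ℤ) = 1 then κ.2 else !κ.2) := rfl

/-- **A signed permutation permutes the unit steps**: `φ_{π,ε} e_κ = e_{stepPerm π ε κ}`. [folklore] -/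
theorem signedPerm_stepVec (π : Equiv.Perm (Fin d)) (ε : Fin d → ℤˣ) (κ : Fin d × Bool) :
    Site.signedPerm π ε (stepVec κ) = stepVec (stepPerm π ε κ) := by
  have hneg : ∀ x : Site d, Site.signedPerm π ε (-x) = -Site.signedPerm π ε x := by
    intro x; funext j; simp
  obtain ⟨i, b⟩ := κ
  rcases Int.units_eq_one_or (ε (π i)) with h | h
  · cases b
    · simp [stepVec, stepPerm_apply, hneg, Site.signedPerm_single, h]
    · simp [stepVec, stepPerm_apply, Site.signedPerm_single, h]
  · cases b
    · simp [stepVec, stepPerm_apply, hneg, Site.signedPerm_single, h]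
    · simp [stepVec, stepPerm_apply, Site.signedPerm_single, h]

/-- One more step (total form, valid for every `k`): `u(k+1) = u(k) + [k < n] e_{u_k}`. [folklore] -/
theorem wordPos_succ' (u : Fin n → Fin d × Bool) (k : ℕ) :
    wordPos u (k + 1) = wordPos u k + (if h : k < n then stepVec (u ⟨k, h⟩) else 0) := by
  simp [wordPos, Finset.sum_range_succ]

/-- **`W_d` transports positions**: the word with permuted steps `σ ∘ u` sits at `φ (u(k))` after `k` steps.
[folklore] -/
theorem wordPos_stepPerm_comp (π : Equiv.Perm (Fin d)) (ε : Fin d → ℤˣ) (u : Fin n → Fin d × Bool) (k : ℕ) :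
    wordPos (stepPerm π ε ∘ u) k = Site.signedPerm π ε (wordPos u k) := by
  induction k with
  | zero => simp
  | succ k ih =>
      rw [wordPos_succ', wordPos_succ', Site.signedPerm_add, ih]
      congr 1
      split_ifs with h
      · rw [Function.comp_apply, signedPerm_stepVec]
      · exact (Site.signedPerm_zero π ε).symm

/-- Self-avoidance is `W_d`-invariant. [folklore] -/
theorem isSAW_stepPerm_comp_iff (π : Equiv.Perm (Fin d)) (ε : Fin d → ℤˣ) (u : Fin n → Fin d × Bool) :
    IsSAW (stepPerm π ε ∘ u) ↔ IsSAW u := by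
  simp only [IsSAW, wordPos_stepPerm_comp, (Site.signedPerm π ε).injective.eq_iff]

/-- Membership in `sawWordsTo`. [folklore] -/
theorem mem_sawWordsTo {x : Site d} {u : Fin n → Fin d × Bool} :
    u ∈ sawWordsTo d n x ↔ IsSAW u ∧ wordPos u n = x := by
  rw [sawWordsTo, mem_filter, mem_sawWords]

/-- `σ ∘ u` is a self-avoiding word to `φ x` iff `u` is one to `x`. [folklore] -/
theorem stepPerm_comp_mem_sawWordsTo_iff (π : Equiv.Perm (Fin d)) (ε : Fin d → ℤˣ) {x : Site d}
    {u : Fin n → Fin d × Bool} :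
    stepPerm π ε ∘ u ∈ sawWordsTo d n (Site.signedPerm π ε x) ↔ u ∈ sawWordsTo d n x := by
  simp only [mem_sawWordsTo, isSAW_stepPerm_comp_iff, wordPos_stepPerm_comp,
    (Site.signedPerm π ε).injective.eq_iff]

/-- **The SAW counts are `W_d`-invariant**: `c_n(φ x) = c_n(x)` for every signed coordinate permutation `φ`
(`u ↦ σ ∘ u` is a bijection `SAW_n(0 → x) → SAW_n(0 → φx)`).
[cite: FitznerVanDerHofstad2016NoBLE, Def. 2.5 p. 1058 (lattice symmetries); §5.3.3 (regrouping by symmetry)] -/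
theorem card_sawWordsTo_signedPerm (π : Equiv.Perm (Fin d)) (ε : Fin d → ℤˣ) (n : ℕ) (x : Site d) :
    (sawWordsTo d n (Site.signedPerm π ε x)).card = (sawWordsTo d n x).card := by
  symm
  refine card_nbij' (fun u => stepPerm π ε ∘ u) (fun u => (stepPerm π ε).symm ∘ u) (fun u hu => ?_)
    (fun u hu => ?_) (fun u _ => ?_) (fun u _ => ?_)
  · exact (stepPerm_comp_mem_sawWordsTo_iff π ε).2 hu
  · have h : stepPerm π ε ∘ ((stepPerm π ε).symm ∘ u) = u := by funext i; simp
    rw [← h] at hu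
    exact (stepPerm_comp_mem_sawWordsTo_iff π ε).1 hu
  · funext i; simp
  · funext i; simp

/-- `x ↦ c_n(x)` is a `W_d`-invariant function. [folklore] -/
theorem signedPermInvariant_card_sawWordsTo (n : ℕ) :
    SignedPermInvariant (fun x : Site d => (sawWordsTo d n x).card) :=
  fun π ε x => card_sawWordsTo_signedPerm π ε n x

/-! ### End points lie in the box of radius `n` -/

/-- `|u(k)_μ| ≤ k`: after `k` unit steps no coordinate exceeds `k` in absolute value. [folklore] -/
theorem natAbs_wordPos_apply_le (u : Fin n → Fin d × Bool) :
    ∀ (k : ℕ) (μ : Fin d), (wordPos u k μ).natAbs ≤ k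
  | 0, μ => by simp
  | k + 1, μ => by
      have ih := natAbs_wordPos_apply_le u k μ
      have hstep : ∀ κ : Fin d × Bool, ((stepVec κ : Site d) μ).natAbs ≤ 1 := by
        rintro ⟨i, b⟩
        cases b <;> by_cases h : μ = i <;> simp [stepVec, h]
      rw [wordPos_succ', Pi.add_apply]
      refine (Int.natAbs_add_le _ _).trans (add_le_add ih ?_)
      split_ifs with h
      · exact hstep _
      · simp

/-- The end point of an `n`-step word (after any `k ≤ n`... indeed any `k`) lies in the box `{‖x‖_∞ ≤ k}`.
[folklore] -/
theorem wordPos_mem_absBox (u : Fin n → Fin d × Bool) (k : ℕ) : wordPos u k ∈ absBox d k :=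
  mem_absBox.2 fun μ => natAbs_wordPos_apply_le u k μ

/-! ### The end-point regrouping -/

/-- **Regrouping a sum over `n`-step self-avoiding words by end point**:
`Σ_{u ∈ SAW_n} F(u(n)) = Σ_{‖x‖_∞ ≤ n} c_n(x) • F(x)`.
[cite: FitznerVanDerHofstad2016NoBLE, §5.3.1 (5.38) (the explicit term μ̄^i (a_i ⊗ X)(x))] -/
theorem sum_sawWords_eq_sum_absBox {β : Type*} [AddCommMonoid β] (n : ℕ) (F : Site d → β) :
    ∑ u ∈ sawWords d n, F (wordPos u n) = ∑ x ∈ absBox d n, (sawWordsTo d n x).card • F x := by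
  rw [← sum_fiberwise_of_maps_to (s := sawWords d n) (t := absBox d n) (g := fun u => wordPos u n)
    (fun u _ => wordPos_mem_absBox u n)]
  refine sum_congr rfl fun x _ => ?_
  rw [← sum_const]
  refine sum_congr rfl fun u hu => ?_
  rw [(mem_filter.1 hu).2]

/-- The same, further regrouped by end-point CLASSES: `Σ_{u ∈ SAW_n} F(u(n)) = Σ_N Σ_{x ∈ class_n(N)} c_n(x) • F(x)`
over the profiles `N = (N_0, …, N_n)` with `Σ N_j = d`. [cite: FitznerVanDerHofstad2016NoBLE, §5.3.3 (the sum over all x ∈ ℤ^d regrouped by symmetry)] -/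
theorem sum_sawWords_eq_sum_pointClass {β : Type*} [AddCommMonoid β] (n : ℕ) (F : Site d → β) :
    ∑ u ∈ sawWords d n, F (wordPos u n) =
      ∑ N ∈ Finset.Nat.antidiagonalTuple (n + 1) d, ∑ x ∈ pointClass d n N, (sawWordsTo d n x).card • F x := by
  rw [sum_sawWords_eq_sum_absBox, sum_absBox_eq_sum_pointClass]

/-- A scalar action of an invariant function on an invariant function is invariant. [folklore] -/
theorem SignedPermInvariant.smul {α β : Type*} [SMul α β] {g : Site d → α} {h : Site d → β}
    (hg : SignedPermInvariant g) (hh : SignedPermInvariant h) : SignedPermInvariant (fun x => g x • h x) := by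
  intro π ε x
  simp only [hg π ε x, hh π ε x]

/-- **The class form for an invariant weight** (the notebooks' `|class| · c_n(class) · X(class)`): for
`W_d`-invariant `F` and ANY choice of representatives `x_N` of the non-empty classes,
`Σ_{u ∈ SAW_n} F(u(n)) = Σ_N #class_n(N) • (c_n(x_N) • F(x_N))`.
[cite: FitznerVanDerHofstad2016NoBLE, §5.3.3 (the sum over all x ∈ ℤ^d regrouped by symmetry)] -/
theorem SignedPermInvariant.sum_sawWords_eq {β : Type*} [AddCommMonoid β] {F : Site d → β}
    (hF : SignedPermInvariant F) (n : ℕ) (rep : (Fin (n + 1) → ℕ) → Site d)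
    (hrep : ∀ N ∈ Finset.Nat.antidiagonalTuple (n + 1) d, (pointClass d n N).Nonempty →
      rep N ∈ pointClass d n N) :
    ∑ u ∈ sawWords d n, F (wordPos u n) =
      ∑ N ∈ Finset.Nat.antidiagonalTuple (n + 1) d,
        (pointClass d n N).card • ((sawWordsTo d n (rep N)).card • F (rep N)) := by
  rw [sum_sawWords_eq_sum_absBox]
  exact ((signedPermInvariant_card_sawWordsTo n).smul hF).sum_absBox_eq rep hrep

/-- In particular the TOTAL count: `σ(n) = #SAW_n = Σ_N #class_n(N) · c_n(x_N)`. [folklore] -/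
theorem card_sawWords_eq_sum_pointClass (n : ℕ) (rep : (Fin (n + 1) → ℕ) → Site d)
    (hrep : ∀ N ∈ Finset.Nat.antidiagonalTuple (n + 1) d, (pointClass d n N).Nonempty →
      rep N ∈ pointClass d n N) :
    (sawWords d n).card =
      ∑ N ∈ Finset.Nat.antidiagonalTuple (n + 1) d, (pointClass d n N).card * (sawWordsTo d n (rep N)).card := by
  have h := (show SignedPermInvariant (fun _ : Site d => (1 : ℕ)) from fun _ _ _ => rfl).sum_sawWords_eq n rep hrep
  simpa using h

/-! ### The consumer's shape (`[0,∞]`-valued weights, real lattice-symmetric `G`) -/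

/-- The tree's real-valued lattice symmetry `IsZdSymmetric` (`LaceExpansionXSpaceAsymptotics`, [Hara2008] §1.1) IS
`SignedPermInvariant` at `β = ℝ` — definitionally; so every `isZdSymmetric_*` theorem of the tree (e.g.
`isZdSymmetric_tau : IsZdSymmetric (tau d p 0)`) feeds the regrouping lemmas above. [folklore] -/
theorem isZdSymmetric_iff_signedPermInvariant {G : Site d → ℝ} : IsZdSymmetric G ↔ SignedPermInvariant G :=
  Iff.rfl

/-- **The weighted SAW sums of the weighted-bubble skeleton, regrouped by end-point classes**: for a
lattice-symmetric real `G` (the consumer takes `G = τ_p(0,·)` or a symmetric majorant of it) and any class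
representatives `x_N`,
`Σ_{u ∈ SAW_n} ofReal ‖u(n)‖₂² · ofReal G(u(n)) = Σ_N #class_n(N) • (c_n(x_N) • (ofReal ‖x_N‖₂² · ofReal G(x_N)))`
— the notebooks' `Σ_class |class| · c_n(class) · ‖class‖₂² · G(class)` behind [NoBLE17-I] §5.3.3.
[cite: FitznerVanDerHofstad2016NoBLE, §5.3.3 (H_z(x) = ‖x‖₂² G_z(x); the sum over all x ∈ ℤ^d regrouped by symmetry)] -/
theorem sum_sawWords_sqNorm_mul_eq_sum_pointClass {G : Site d → ℝ} (hG : IsZdSymmetric G) (n : ℕ)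
    (rep : (Fin (n + 1) → ℕ) → Site d)
    (hrep : ∀ N ∈ Finset.Nat.antidiagonalTuple (n + 1) d, (pointClass d n N).Nonempty →
      rep N ∈ pointClass d n N) :
    ∑ u ∈ sawWords d n, ENNReal.ofReal (euclidNorm (wordPos u n) ^ 2) * ENNReal.ofReal (G (wordPos u n)) =
      ∑ N ∈ Finset.Nat.antidiagonalTuple (n + 1) d, (pointClass d n N).card •
        ((sawWordsTo d n (rep N)).card •
          (ENNReal.ofReal (euclidNorm (rep N) ^ 2) * ENNReal.ofReal (G (rep N)))) := by
  have hF : SignedPermInvariant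
      (fun x : Site d => ENNReal.ofReal (euclidNorm x ^ 2) * ENNReal.ofReal (G x)) :=
    (signedPermInvariant_euclidNorm_sq.comp ENNReal.ofReal).mul
      ((isZdSymmetric_iff_signedPermInvariant.1 hG).comp ENNReal.ofReal)
  exact hF.sum_sawWords_eq n rep hrep

end Literature.Probability.FitznerVanDerHofstad2017
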